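import Literature.Probability.Percolation.RSW
import Mathlib.Analysis.SpecialFunctions.Pow.Real

/-!
# Stub `stub_incrementLimit` (line `registered`, crux `SimilarityUpgrade`, stmt-CriticalPhenomena-4597)

Crux `Summit.CriticalPhenomena.CardyFormulaZ2.Theses.CardyWhiteToColoured.SimilarityUpgrade`,
line `registered` (skeleton `Cruxes/SimilarityUpgrade/Lines/birth.lean`), stub **A2**
`stub_incrementLimit`: pure real analysis. From the discrete increment bound

`crossingProb half m k - crossingProb half (m + j) k ≤ C j (k + 1) / s² + C ((j + s) / m) ^ α`

(valid for `K ≤ s ≤ m`, `K (j + s) ≤ m`, `2 s ≤ k`) and antitonicity of `crossingProb` in the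
width (`crossingProb_anti_left`, so the increment is `≥ 0`), the `ε`-form follows: in the aspect
window `a k ≤ m ≤ k / a`, adding `j ≤ ε k` columns moves the crossing probability of the
`m × k` box by at most `η`, uniformly in `k ≥ k₀`.

Proof. Pick `θ ∈ (0, 1/2]` with `θ ≤ a / (2K)`, `16 C θ ≤ η` and `θ ≤ (a/2) u` where
`u ^ α = η / (2C)`; put `ε := θ³`, `s := ⌊θ k⌋₊`, `k₀ := ⌈2K/θ⌉₊`. For `k ≥ k₀` one has
`θ k / 2 ≤ s ≤ θ k`, the side conditions of the discrete bound hold, `j (k+1) / s² ≤ 8 θ` and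
`(j + s)/m ≤ 2θ/a ≤ u`, whence the increment is at most `8 C θ + C u ^ α ≤ η/2 + η/2`. The upper
half `m ≤ k / a` of the aspect window is not needed.

References: standard real analysis (no single source); the discrete bound is the neighbouring stub
`stub_incrementBound` of the same line and enters here only as a hypothesis.
-/

namespace Summit.CriticalPhenomena.CardyFormulaZ2.Cruxes.SimilarityUpgrade.Stubs

open Literature.Probability.Percolation

/-- Four positive reals have a common positive lower bound. [folklore] -/
private theorem exists_pos_le_four {b₁ b₂ b₃ b₄ : ℝ} (h₁ : 0 < b₁) (h₂ : 0 < b₂) (h₃ : 0 < b₃)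
    (h₄ : 0 < b₄) : ∃ θ : ℝ, 0 < θ ∧ θ ≤ b₁ ∧ θ ≤ b₂ ∧ θ ≤ b₃ ∧ θ ≤ b₄ :=
  ⟨min (min b₁ b₂) (min b₃ b₄), lt_min (lt_min h₁ h₂) (lt_min h₃ h₄),
    (min_le_left _ _).trans (min_le_left _ _), (min_le_left _ _).trans (min_le_right _ _),
    (min_le_right _ _).trans (min_le_left _ _), (min_le_right _ _).trans (min_le_right _ _)⟩

/-- The scale `s := ⌊θ k⌋₊` satisfies `θ k / 2 ≤ s ≤ θ k` and `θ k - 1 < s` once `2 ≤ θ k`.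
[folklore] -/
private theorem floor_scale_bounds {θ : ℝ} {k : ℕ} (hθk : 2 ≤ θ * k) :
    θ * k / 2 ≤ (⌊θ * k⌋₊ : ℝ) ∧ (⌊θ * k⌋₊ : ℝ) ≤ θ * k ∧ θ * k - 1 < (⌊θ * k⌋₊ : ℝ) := by
  have h0 : 0 ≤ θ * k := by linarith
  have h1 : θ * k - 1 < (⌊θ * k⌋₊ : ℝ) := Nat.sub_one_lt_floor _
  exact ⟨by linarith, Nat.floor_le h0, h1⟩

/-- **stub_incrementLimit (A2, real analysis) of line `registered`, crux `SimilarityUpgrade`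
(stmt-CriticalPhenomena-4597).** From the discrete bound
`crossingProb m k - crossingProb (m+j) k ≤ C j (k+1)/s² + C ((j+s)/m)^α` (valid for
`K ≤ s ≤ m`, `K (j+s) ≤ m`, `2s ≤ k`) and monotonicity in the width (`crossingProb_anti_left`, so
the difference is `≥ 0`) to the ε-form: given the aspect window `a k ≤ m ≤ k/a` and `η > 0`,
there are `ε > 0` and `k₀` such that `|crossingProb m k - crossingProb (m+j) k| ≤ η` whenever
`k ≥ k₀` and `j ≤ ε k`. Choice: `ε := θ³`, `s := ⌊θ k⌋₊`, `k₀ := ⌈2K/θ⌉₊` with `θ` small.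
[folklore] -/
theorem stub_incrementLimit :
    (∃ C α : ℝ, 0 < C ∧ 0 < α ∧ ∃ K : ℕ, 1 ≤ K ∧ ∀ (m j k s : ℕ), K ≤ s → K * (j + s) ≤ m →
      s ≤ m → 2 * s ≤ k →
      crossingProb half m k - crossingProb half (m + j) k ≤
        C * ((j : ℝ) * ((k : ℝ) + 1) / (s : ℝ) ^ 2) + C * (((j : ℝ) + s) / m) ^ α) →
    ∀ a : ℝ, 0 < a → ∀ η : ℝ, 0 < η → ∃ ε : ℝ, 0 < ε ∧ ∃ k₀ : ℕ, ∀ k m j : ℕ, k₀ ≤ k →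
      a * k ≤ m → (m : ℝ) ≤ k / a → (j : ℝ) ≤ ε * k →
      |crossingProb half m k - crossingProb half (m + j) k| ≤ η := by
  rintro ⟨C, α, hC, hα, K, hK, hbound⟩ a ha η hη
  have hK1 : (1 : ℝ) ≤ K := by exact_mod_cast hK
  have hKpos : (0 : ℝ) < K := by linarith
  have hCne : C ≠ 0 := hC.ne'
  -- the auxiliary level `u` with `u ^ α = η / (2 C)`
  obtain ⟨u, hu, huα⟩ : ∃ u : ℝ, 0 < u ∧ u ^ α = η / (2 * C) :=
    ⟨(η / (2 * C)) ^ α⁻¹, Real.rpow_pos_of_pos (by positivity) _,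
      Real.rpow_inv_rpow (by positivity) hα.ne'⟩
  -- choose θ
  obtain ⟨θ, hθ, hθ1, hθ2, hθ3, hθ4⟩ := exists_pos_le_four (b₁ := 1 / 2) (b₂ := a / (2 * K))
    (b₃ := η / (16 * C)) (b₄ := a / 2 * u) (by norm_num) (by positivity) (by positivity)
    (by positivity)
  have hθle1 : θ ≤ 1 := by linarith
  have hθ3le : θ ^ 3 ≤ θ := pow_le_of_le_one hθ.le hθle1 (by norm_num)
  have h2Kθ : θ * (2 * K) ≤ a := (le_div_iff₀ (by positivity)).mp hθ2
  have hθa : θ ≤ a := by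
    have : θ ≤ θ * (2 * K) := le_mul_of_one_le_right hθ.le (by linarith)
    linarith
  have h16 : θ * (16 * C) ≤ η := (le_div_iff₀ (by positivity)).mp hθ3
  have h2θ : 2 * θ ≤ a * u := by linarith
  refine ⟨θ ^ 3, by positivity, ⌈2 * K / θ⌉₊, ?_⟩
  intro k m j hk hakm _ hj
  -- size of `k`
  have hk' : 2 * K / θ ≤ k := (Nat.le_ceil _).trans (by exact_mod_cast hk)
  have hθk : 2 * K ≤ θ * k := by
    rw [div_le_iff₀ hθ] at hk'
    linarith
  have hθk2 : 2 ≤ θ * k := by linarith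
  have hk0 : 0 < (k : ℝ) := pos_of_mul_pos_right (by linarith : (0 : ℝ) < θ * k) hθ.le
  have hk1 : (1 : ℝ) ≤ k := by
    have : θ * k ≤ 1 / 2 * k := mul_le_mul_of_nonneg_right hθ1 (Nat.cast_nonneg k)
    linarith
  have hm : 0 < (m : ℝ) := lt_of_lt_of_le (mul_pos ha hk0) hakm
  -- the scale `s`
  obtain ⟨hs_ge, hs_le, hs_gt⟩ := floor_scale_bounds (k := k) hθk2
  generalize ⌊θ * (k : ℝ)⌋₊ = s at hs_ge hs_le hs_gt
  have hs0 : 0 < (s : ℝ) := by linarith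
  -- side conditions of the discrete bound
  have hKs : K ≤ s := by
    have : (K : ℝ) < s := by linarith
    exact (Nat.cast_lt.mp this).le
  have hjs : (j : ℝ) + s ≤ 2 * θ * k := by
    have : θ ^ 3 * k ≤ θ * k := mul_le_mul_of_nonneg_right hθ3le (Nat.cast_nonneg k)
    linarith
  have hKjs : K * (j + s) ≤ m := by
    have h1 : (K : ℝ) * (j + s) ≤ K * (2 * θ * k) := mul_le_mul_of_nonneg_left hjs hKpos.le
    have h2 : (K : ℝ) * (2 * θ * k) = θ * (2 * K) * k := by ring
    have h3 : θ * (2 * K) * k ≤ a * k := mul_le_mul_of_nonneg_right h2Kθ (Nat.cast_nonneg k)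
    have : ((K * (j + s) : ℕ) : ℝ) ≤ m := by
      push_cast
      linarith
    exact_mod_cast this
  have hsm : s ≤ m := by
    have h3 : θ * k ≤ a * k := mul_le_mul_of_nonneg_right hθa (Nat.cast_nonneg k)
    have : (s : ℝ) ≤ m := by linarith
    exact_mod_cast this
  have h2sk : 2 * s ≤ k := by
    have h3 : θ * k ≤ 1 / 2 * k := mul_le_mul_of_nonneg_right hθ1 (Nat.cast_nonneg k)
    have : ((2 * s : ℕ) : ℝ) ≤ k := by
      push_cast
      linarith
    exact_mod_cast this
  have hb := hbound m j k s hKs hKjs hsm h2sk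
  -- first term: `j (k+1) / s² ≤ 8 θ`
  have hT1 : (j : ℝ) * ((k : ℝ) + 1) / (s : ℝ) ^ 2 ≤ 8 * θ := by
    rw [div_le_iff₀ (by positivity)]
    have hjk : (j : ℝ) * ((k : ℝ) + 1) ≤ θ ^ 3 * k * (2 * k) :=
      mul_le_mul hj (by linarith) (by positivity) (by positivity)
    have hs2 : (θ * k / 2) ^ 2 ≤ (s : ℝ) ^ 2 := pow_le_pow_left₀ (by positivity) hs_ge 2
    have h8 : 8 * θ * (θ * k / 2) ^ 2 ≤ 8 * θ * (s : ℝ) ^ 2 :=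
      mul_le_mul_of_nonneg_left hs2 (by positivity)
    have hid : θ ^ 3 * k * (2 * k) = 8 * θ * (θ * k / 2) ^ 2 := by ring
    linarith
  -- second term: `((j+s)/m)^α ≤ u^α = η/(2C)`
  have hT2 : (((j : ℝ) + s) / m) ^ α ≤ η / (2 * C) := by
    have hr : ((j : ℝ) + s) / m ≤ u := by
      rw [div_le_iff₀ hm]
      calc (j : ℝ) + s ≤ 2 * θ * k := hjs
        _ ≤ a * u * k := mul_le_mul_of_nonneg_right h2θ (Nat.cast_nonneg k)
        _ = u * (a * k) := by ring
        _ ≤ u * m := mul_le_mul_of_nonneg_left hakm hu.le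
    have hr0 : 0 ≤ ((j : ℝ) + s) / m := by positivity
    exact (Real.rpow_le_rpow hr0 hr hα.le).trans_eq huα
  -- conclusion
  have hC1 : C * ((j : ℝ) * ((k : ℝ) + 1) / (s : ℝ) ^ 2) ≤ C * (8 * θ) :=
    mul_le_mul_of_nonneg_left hT1 hC.le
  have hC2 : C * (((j : ℝ) + s) / m) ^ α ≤ C * (η / (2 * C)) :=
    mul_le_mul_of_nonneg_left hT2 hC.le
  have hC2' : C * (η / (2 * C)) = η / 2 := by
    field_simp
  have hnonneg : 0 ≤ crossingProb half m k - crossingProb half (m + j) k :=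
    sub_nonneg.mpr (crossingProb_anti_left half (Nat.le_add_right m j) k)
  rw [abs_of_nonneg hnonneg]
  linarith

end Summit.CriticalPhenomena.CardyFormulaZ2.Cruxes.SimilarityUpgrade.Stubs
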